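import Literature.RingTheory.FormalGroups.FormalOModuleBudCongr   -- ★ `IsOModuleBud`, defects, `IsOModuleBud.congr`; brings ★ `FormalOModuleLaw`, ★ `DegreeCongruence`
import HarnessLib

/-!
# A formal `𝒪`-module law from a compatible tower of BUDS: the limit of `(F_n, ρ_n)`, `m_n`-buds with `m_n → ∞`
# ([Lazard 1955] §II «bourgeons»; [Tate 1967] §2.2, proof of Prop. 1; [Drinfeld 1974] §1)

Topic `Literature/RingTheory/FormalGroups`; namespace `Literature.RingTheory.FormalGroups`.  THEOREMS ONLY (no definition, no
named fact, no instance, no notation, no `sorry`); over ★ `FormalOModuleBud` ∕ ★ `FormalOModuleBudCongr` (`IsOModuleBud 𝒪 m F ρ` = the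
seven axioms of a formal `𝒪`-module law modulo total degree `m + 1`; `IsOModuleBud.congr`) and ★ `DegreeCongruence`
(`↑N ≤ (F − G).order` = «`F ≡ G (mod deg N)`»).  Cell `hodgecm-mathlib`, P6 «MOD programme», sub-desk F0P6d, letter (HL-D)
`ConnectedDimOneIsOModuleLaw`, strategy σ1 (sequel of ★ `MonogenicTowerCoordinates` p844858 and of
`FormalGroupOfTruncatedLaws`): in compatible coordinates the layers of a connected `p`-divisible `𝒪`-module give laws-with-action
`(F_n, ρ_n)` exact modulo increasing degree; this file assembles them into ONE ★ `FormalOModuleLaw 𝒪 B` — law AND action in one go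
(pointer F0P3b-p01 (g9) 14:10:06Z).  It is equally the assembly step of the Lazard ∕ Drinfeld bud-by-bud constructions.  HC_CM is
proved only modulo the printed citations until rung 0 closes; nothing here is about HC.

THE PRINT.  [Lazard1955] §II: a «bourgeon d'ordre m» is a law exact modulo degree `m + 1`; a compatible sequence of bourgeons of
increasing order defines a formal group law (the limit), used in the construction of the universal law.  [Tate1967] §2.2, proof of
Prop. 1: the formal Lie group of a connected `p`-divisible group is obtained as the limit of its layers.  [Drinfeld1974] §1: formal
`𝒪`-modules (law + ring action with tangent condition).

MAIN STATEMENTS.  §1 `coeff_eq_of_orderCompatible`, **`existsUnique_of_orderCompatible`** (any index type: a tower `F_{n+1} ≡ F_n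
(mod deg m_n + 1)`, `m` non-decreasing unbounded, has a unique limit `G ≡ F_n (mod deg m_n + 1)`); §2 `coeff_single_zero_of_two_le_order`,
`coeff_single_one_of_two_le_order`, **`exists_formalOModuleLaw_of_buds`** (`m` non-decreasing, unbounded, `≥ 1`; `IsOModuleBud 𝒪 (m n)
(F n) (ρ n)`; `F (n+1) ≡ F n`, `ρ (n+1) a ≡ ρ n a (mod deg m n + 1)` ⇒ `∃ M : FormalOModuleLaw 𝒪 B` with `M.F ≡ F n`,
`[a]_M ≡ ρ n a (mod deg m n + 1)`), **`formalOModuleLaw_unique_of_buds`** (law and action series are determined).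

## References
* [Lazard1955] M. Lazard, *Sur les groupes de Lie formels à un paramètre*, Bull. SMF 83 (1955) — §I Lemme 1, §II (bourgeons).
* [Tate1967] J. T. Tate, *p-divisible groups*, Proc. Conf. Local Fields (Driebergen, 1966), Springer (1967) — §2.2, proof of Prop. 1.
* [Drinfeld1974] V. G. Drinfeld, *Elliptic modules*, Math. USSR-Sb. 23 (1974) — §1, Definition.
-/

noncomputable section

namespace Literature.RingTheory.FormalGroups

open MvPowerSeries Finsupp

universe u v

variable {𝒪 : Type u} [CommRing 𝒪] {B : Type v} [CommRing B] [Algebra 𝒪 B]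

/-! ## §1 Limits in the total-degree currency `↑N ≤ (F − G).order` -/

section Limit

variable {τ : Type*}

/-- Along a tower `F_{n+1} ≡ F_n (mod deg m_n + 1)` with `m` non-decreasing, `F_{n'} ≡ F_n (mod deg m_n + 1)` for `n ≤ n′`.
[cite: Lazard1955, §I Lemme 1] -/
theorem coeff_eq_of_orderCompatible {m : ℕ → ℕ} (hmono : Monotone m) {F : ℕ → MvPowerSeries τ B}
    (hcompat : ∀ n, ((m n + 1 : ℕ) : ℕ∞) ≤ (F (n + 1) - F n).order) {n n' : ℕ} (hnn : n ≤ n') (d : τ →₀ ℕ)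
    (hd : d.degree < m n + 1) : coeff d (F n') = coeff d (F n) := by
  induction n', hnn using Nat.le_induction with
  | base => rfl
  | succ n' hnn ih =>
    rw [← ih]
    exact (natCast_le_order_sub_iff.1 (hcompat n')) d (lt_of_lt_of_le hd (Nat.succ_le_succ (hmono hnn)))

/-- **A tower of series compatible modulo increasing total degree has a unique limit**: `F_{n+1} ≡ F_n (mod deg m_n+1)`, `m`
non-decreasing and unbounded ⇒ `∃! G, ∀ n, G ≡ F_n (mod deg m_n + 1)`. [cite: Lazard1955, §I Lemme 1] [cite: Tate1967, §2.2 (proof of Prop. 1)] -/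
theorem existsUnique_of_orderCompatible {m : ℕ → ℕ} (hmono : Monotone m) (hm : ∀ k, ∃ n, k ≤ m n) (F : ℕ → MvPowerSeries τ B)
    (hcompat : ∀ n, ((m n + 1 : ℕ) : ℕ∞) ≤ (F (n + 1) - F n).order) :
    ∃! G : MvPowerSeries τ B, ∀ n, ((m n + 1 : ℕ) : ℕ∞) ≤ (G - F n).order := by
  choose ℓ hℓ using hm
  refine ⟨fun d => coeff d (F (ℓ d.degree)), fun n => ?_, fun G hG => ?_⟩
  · refine natCast_le_order_sub_iff.2 fun d hd => ?_
    show coeff d (F (ℓ d.degree)) = coeff d (F n)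
    rw [← coeff_eq_of_orderCompatible hmono hcompat (le_max_right n (ℓ d.degree)) d (Nat.lt_succ_of_le (hℓ _)),
      coeff_eq_of_orderCompatible hmono hcompat (le_max_left n (ℓ d.degree)) d hd]
  · ext d
    show coeff d G = coeff d (F (ℓ d.degree))
    exact (natCast_le_order_sub_iff.1 (hG (ℓ d.degree))) d (Nat.lt_succ_of_le (hℓ _))

/-- If `↑(m n + 1) ≤ x` for an unbounded `m`, then `x = ⊤`. [folklore] -/
private theorem enat_eq_top_of_forall {m : ℕ → ℕ} (hm : ∀ k, ∃ n, k ≤ m n) {x : ℕ∞} (hx : ∀ n, ((m n + 1 : ℕ) : ℕ∞) ≤ x) :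
    x = ⊤ := by
  refine ENat.eq_top_iff_forall_ge.2 fun k => ?_
  obtain ⟨n, hn⟩ := hm k
  exact le_trans (by exact_mod_cast Nat.le_succ_of_le hn) (hx n)

/-- A series congruent to `0` modulo every degree is `0`. [folklore] -/
private theorem eq_zero_of_forall_le_order {σ : Type*} {m : ℕ → ℕ} (hm : ∀ k, ∃ n, k ≤ m n) {D : MvPowerSeries σ B}
    (hD : ∀ n, ((m n + 1 : ℕ) : ℕ∞) ≤ D.order) : D = 0 :=
  order_eq_top_iff.1 (enat_eq_top_of_forall hm hD)

end Limit

/-! ## §2 The formal `𝒪`-module law of a compatible tower of buds -/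

/-- The `X₀`-coefficient of a series with `F ≡ X₀ + X₁ (mod deg 2)` is `1`. [cite: Lazard1955, §II (bourgeons)] -/
theorem coeff_single_zero_of_two_le_order {F : MvPowerSeries (Fin 2) B} (h : ((2 : ℕ) : ℕ∞) ≤ (F - X 0 - X 1).order) :
    coeff (Finsupp.single 0 1) F = 1 := by
  classical
  have h' := (natCast_le_order_iff.1 h) (Finsupp.single 0 1) (by rw [degree_single]; exact Nat.lt_succ_self 1)
  have hne : (Finsupp.single (0 : Fin 2) 1 : Fin 2 →₀ ℕ) ≠ Finsupp.single 1 1 := by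
    rw [Ne, Finsupp.single_eq_single_iff]; simp
  rw [map_sub, map_sub, coeff_X, coeff_X, if_pos rfl, if_neg hne, sub_zero, sub_eq_zero] at h'
  exact h'

/-- The `X₁`-coefficient of a series with `F ≡ X₀ + X₁ (mod deg 2)` is `1`. [cite: Lazard1955, §II (bourgeons)] -/
theorem coeff_single_one_of_two_le_order {F : MvPowerSeries (Fin 2) B} (h : ((2 : ℕ) : ℕ∞) ≤ (F - X 0 - X 1).order) :
    coeff (Finsupp.single 1 1) F = 1 := by
  classical
  have h' := (natCast_le_order_iff.1 h) (Finsupp.single 1 1) (by rw [degree_single]; exact Nat.lt_succ_self 1)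
  have hne : (Finsupp.single (1 : Fin 2) 1 : Fin 2 →₀ ℕ) ≠ Finsupp.single 0 1 := by
    rw [Ne, Finsupp.single_eq_single_iff]; simp
  rw [map_sub, map_sub, coeff_X, coeff_X, if_neg hne, if_pos rfl, sub_zero, sub_eq_zero] at h'
  exact h'

/-- **A FORMAL `𝒪`-MODULE LAW FROM A COMPATIBLE TOWER OF BUDS.**  Let `m : ℕ → ℕ` be non-decreasing and unbounded with `m n ≥ 1`,
and let `(F_n, ρ_n)` be `m_n`-buds of formal `𝒪`-module laws over `B` (★ `IsOModuleBud`: the seven axioms modulo total degree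
`m_n + 1`) with `F_{n+1} ≡ F_n`, `ρ_{n+1}(a) ≡ ρ_n(a) (mod deg m_n + 1)`.  Then the limits form a formal `𝒪`-module law `M` over
`B` (★ `FormalOModuleLaw`) with `M.F ≡ F_n` and `[a]_M ≡ ρ_n(a) (mod deg m_n + 1)` for every `n` — all seven defects of the limit
vanish modulo every degree by ★ `IsOModuleBud.congr`, hence vanish.  (The law-with-action of a connected `p`-divisible `𝒪`-module
from its layers; also the assembly step of the Lazard ∕ Drinfeld bud constructions.)
[cite: Lazard1955, §II (bourgeons)] [cite: Tate1967, §2.2 (proof of Prop. 1)] [cite: Drinfeld1974, §1 Def.] -/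
theorem exists_formalOModuleLaw_of_buds {m : ℕ → ℕ} (hmono : Monotone m) (hm : ∀ k, ∃ n, k ≤ m n) (h1 : ∀ n, 1 ≤ m n)
    (F : ℕ → MvPowerSeries (Fin 2) B) (ρ : ℕ → 𝒪 → PowerSeries B) (hbud : ∀ n, IsOModuleBud 𝒪 (m n) (F n) (ρ n))
    (hF : ∀ n, ((m n + 1 : ℕ) : ℕ∞) ≤ (F (n + 1) - F n).order)
    (hρ : ∀ n a, ((m n + 1 : ℕ) : ℕ∞) ≤ MvPowerSeries.order (ρ (n + 1) a - ρ n a)) :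
    ∃ M : FormalOModuleLaw 𝒪 B, (∀ n, ((m n + 1 : ℕ) : ℕ∞) ≤ (M.toFormalGroup.toPowerSeries - F n).order) ∧
      ∀ n a, ((m n + 1 : ℕ) : ℕ∞) ≤ MvPowerSeries.order ((M.act a).toPowerSeries - ρ n a) := by
  -- the limits
  obtain ⟨G, hG, -⟩ := existsUnique_of_orderCompatible hmono hm F hF
  have hφex : ∀ a : 𝒪, ∃ φ : PowerSeries B, ∀ n, ((m n + 1 : ℕ) : ℕ∞) ≤ MvPowerSeries.order (φ - ρ n a) := fun a =>
    (existsUnique_of_orderCompatible hmono hm (fun n => ρ n a) (fun n => hρ n a)).exists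
  choose φ hφ using hφex
  -- constant terms
  have hG0 : constantCoeff G = 0 := by
    have h := (natCast_le_order_sub_iff.1 (hG 0)) 0 (by simp)
    rw [MvPowerSeries.coeff_zero_eq_constantCoeff_apply, MvPowerSeries.coeff_zero_eq_constantCoeff_apply] at h
    rw [h]; exact (hbud 0).constantCoeff_F
  have hφ0 : ∀ a, PowerSeries.constantCoeff (φ a) = 0 := fun a => by
    have h := (natCast_le_order_sub_iff.1 (hφ a 0)) 0 (by simp)
    rw [MvPowerSeries.coeff_zero_eq_constantCoeff_apply, MvPowerSeries.coeff_zero_eq_constantCoeff_apply] at h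
    exact h.trans ((hbud 0).constantCoeff_ρ a)
  -- the limit is a bud of every order
  have hbud' : ∀ n, IsOModuleBud 𝒪 (m n) G φ := fun n =>
    (hbud n).congr (h1 n) hG0 hφ0 (hG n) (fun a => hφ a n)
  -- hence every defect vanishes
  have hassoc : assocDefect G = 0 := eq_zero_of_forall_le_order hm fun n => (hbud' n).assoc
  have hcomm : commDefect G = 0 := eq_zero_of_forall_le_order hm fun n => (hbud' n).comm
  have hhom : ∀ a, homDefect G (φ a) = 0 := fun a => eq_zero_of_forall_le_order hm fun n => (hbud' n).hom a
  have hadd : ∀ a b, addDefect G (φ a) (φ b) (φ (a + b)) = 0 := fun a b =>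
    eq_zero_of_forall_le_order hm fun n => (hbud' n).add a b
  have hmul : ∀ a b, mulDefect (φ a) (φ b) (φ (a * b)) = 0 := fun a b =>
    eq_zero_of_forall_le_order hm fun n => (hbud' n).mul a b
  have hone : φ 1 - PowerSeries.X = 0 := eq_zero_of_forall_le_order hm fun n => (hbud' n).one
  have hzero : φ 0 = 0 := eq_zero_of_forall_le_order hm fun n => (hbud' n).zero
  -- the formal group law
  let FG : FormalGroup B :=
    { toPowerSeries := G
      zero_constantCoeff := hG0
      lin_coeff_X := coeff_single_zero_of_two_le_order (hbud' 0).two_le_order_F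
      lin_coeff_Y := coeff_single_one_of_two_le_order (hbud' 0).two_le_order_F
      assoc := sub_eq_zero.1 hassoc }
  haveI hcommI : FG.IsComm := ⟨(sub_eq_zero.1 hcomm)⟩
  let act : 𝒪 → FormalGroupHom FG FG := fun a =>
    { toPowerSeries := φ a
      constantCoeff_eq_zero := hφ0 a
      map_add := sub_eq_zero.1 (hhom a) }
  refine ⟨{ toFormalGroup := FG
            isComm := hcommI
            act := act
            coeff_one_act := fun a => (hbud' 0).coeff_one_ρ a
            act_zero := hzero
            act_one := sub_eq_zero.1 hone
            act_add := fun a b => sub_eq_zero.1 (hadd a b)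
            act_mul := fun a b => sub_eq_zero.1 (hmul a b) }, hG, fun n a => hφ a n⟩

/-- **Uniqueness**: the law and the action series are determined by the congruences with the tower. [cite: Tate1967, §2.2 (proof of Prop. 1)] -/
theorem formalOModuleLaw_unique_of_buds {m : ℕ → ℕ} (hmono : Monotone m) (hm : ∀ k, ∃ n, k ≤ m n)
    (F : ℕ → MvPowerSeries (Fin 2) B) (ρ : ℕ → 𝒪 → PowerSeries B)
    (hF : ∀ n, ((m n + 1 : ℕ) : ℕ∞) ≤ (F (n + 1) - F n).order)
    (hρ : ∀ n a, ((m n + 1 : ℕ) : ℕ∞) ≤ MvPowerSeries.order (ρ (n + 1) a - ρ n a))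
    (M M' : FormalOModuleLaw 𝒪 B)
    (hM : ∀ n, ((m n + 1 : ℕ) : ℕ∞) ≤ (M.toFormalGroup.toPowerSeries - F n).order)
    (hM' : ∀ n, ((m n + 1 : ℕ) : ℕ∞) ≤ (M'.toFormalGroup.toPowerSeries - F n).order)
    (hMa : ∀ n a, ((m n + 1 : ℕ) : ℕ∞) ≤ MvPowerSeries.order ((M.act a).toPowerSeries - ρ n a))
    (hM'a : ∀ n a, ((m n + 1 : ℕ) : ℕ∞) ≤ MvPowerSeries.order ((M'.act a).toPowerSeries - ρ n a)) :
    M.toFormalGroup = M'.toFormalGroup ∧ ∀ a, (M.act a).toPowerSeries = (M'.act a).toPowerSeries := by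
  obtain ⟨G, -, hGu⟩ := existsUnique_of_orderCompatible hmono hm F hF
  refine ⟨FormalGroup.ext ((hGu _ hM).trans (hGu _ hM').symm), fun a => ?_⟩
  obtain ⟨ψ, -, hψu⟩ := existsUnique_of_orderCompatible hmono hm (fun n => ρ n a) (fun n => hρ n a)
  exact (hψu _ fun n => hMa n a).trans (hψu _ fun n => hM'a n a).symm

end Literature.RingTheory.FormalGroups
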